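import Literature.MathematicalPhysics.QuantumLattice.HubbardTTPrimePolarizedSeaCapTable
import HarnessLib

/-!
# The free-fermion SANDWICH of a material box: hypothesis-free floor (bathtub rows at the two `t'` ends,
# joined by concavity) and Hartree–Fock / polarised caps from ONE kernel certificate shape

Family `hubbard` (topic `MathematicalPhysics/QuantumLattice`; companion of `HubbardTTPrimePolarizedSeaCapTable`
(the certificate checker `polarizedPlaneCheck`), `HubbardTTPrimeFreeSeaGridCeiling` (the doubly-filled grid-cell
sea cap PLANE `energyDensityTT'_le_freeSea_plane`), `HubbardFermiSeaCellRows` (kernel free-gas FLOOR rows, affine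
in the density: `FermiSeaCellRows.energyDensityTT'_one_ge_affine_cellTable64`) and `HubbardTTPrimeBoxWordExtension`
(S2-seam shapes)). Written for stage S2 «certifier families: points → BOXES» of the Hubbard material-oracle
programme (crew hubbard-fast, seat hubbard-box-p2 «box ⊂ union of certified cells ⇒ word», 2026-08-27).

Every one-band material box the S1 router hands over is a product
`[U₁, U₂] × [s₁, s₂] × [n₁, n₂]` of the `(U/t, t'/t, n)` space. The cell words of record on such boxes carry
registry rows as hypotheses. This file assembles the ONE window that needs no hypothesis at all — the
zeroth-order ("free-fermion sandwich") window — from kernel-decidable certificates: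

* §1 **Caps from the polarised-sea certificate, doubly filled.** If `polarizedPlaneCheck M t s₁ s₂ sel card A B`
  succeeds then, besides the `U`-uniform polarised cap `e ≤ A + t'B` at density `card/M²`
  (`energyDensityTT'_le_affine_of_polarizedPlaneCheck`), the SAME certificate read with both spin species
  gives the Hartree–Fock cap `e(t, t', U, n) ≤ 2(A + t'B) + U(n/2)²` at density `n = 2·card/M²`
  (`energyDensityTT'_le_hartreeFock_of_polarizedPlaneCheck`; the paramagnetic Slater determinant,
  `energyDensityTT'_le_freeSea_plane`, Bach–Lieb–Solovej (2c.36)) — the right cap at weak coupling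
  (`U(n/2)² < ` polarisation cost), with its rectangle and 3-D slab consumer shapes.
* §2 **Floor of a box from two affine free floors.** Rows `F + μ·n ≤ e(t, s, U, n)` (all `U ≥ 0`, all
  `0 ≤ n < 2`) at the two ends `s = s₁, s₂` of the `t'`-interval give, on the whole box, the floor
  `min over the four (end, density-end) values` (`energyDensityTT'_ge_of_affineFloors`, seam shape
  `energyDensityTT'_floor_Icc₃_of_affineFloors`): affine in `n` ⇒ extreme at a density end; CONCAVE in `t'`
  (`energyDensityTT'_ge_convexComb`, Israel I.3.4) ⇒ above the chord of the two end floors; monotone in `U`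
  is not even needed (the rows hold at every `U ≥ 0`).
* §3 **The sandwich** = §2 ⊕ (§1 ∧ polarised caps, by `min`) in the S2-seam shape
  (`energyDensityTT'_sandwich_Icc₃`), ready for `Downfold.holdsOn_of_forall_s2Box` / the kd-cover theorems.

Everything is PROVED; no new definition, no named fact, no number. HONEST FRAMING: one-body windows — the
floor is the `U = 0` gas, the caps are single Slater determinants; widths `≈ U(n/2)²` at weak coupling and
`≈ 0.8–1.1 t` on open-`U` cuprate boxes. Coverage and an unconditional outer hull, not tightness; no phase word.

## Mathlib / tree search

REUSED: `TTPrimeFree.polarizedPlaneCheck` and its interval plumbing (`planeASum`, `planeBSum`, `affineHi`,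
`mem_selSumFI`, `mem_gridSigmaFI`, `countSel`, `sumNat_eq`), `energyDensityTT'_le_freeSea_plane`,
`energyDensityTT'_ge_convexComb`, `energyDensityTT'_cap_Icc₃_of_affineCaps`, `energyDensityTT'_cap_Icc₃_min`,
`energyDensityTT'_window_Icc₃_of_floor_of_cap`, `mem_Icc_vec3_iff`. `lean search 'hartreeFock_of_polarized|affineFloors|sandwich'`:
nothing box-level in the tree (the HF table adapter `energyDensityTT'_le_of_freeSeaTable` takes real tables, not a
decidable certificate; the free rows are stated at points of `(t', n)`).

## References

* V. Bach, E. H. Lieb, J. P. Solovej, J. Stat. Phys. 76 (1994) 3, eq. (2c.36) (Slater determinants are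
  variational; the Hartree–Fock functional). [cite: BachLiebSolovej1994, eq. (2c.36)]
* E. H. Lieb, M. Loss, Duke Math. J. 71 (1993) 337, §8, Theorem 8.2 (sum of the lowest eigenvalues /
  bathtub). [cite: LiebLoss1993, §8, Theorem 8.2]
* R. B. Israel, *Convexity in the Theory of Lattice Gases* (1979), Thm. I.3.4 (concavity of the ground-state
  energy in the couplings). [cite: Israel1979, Thm. I.3.4]
* A. Neumaier, Acta Numerica 13 (2004) 271, §11 (rigorous bounds by interval evaluation).
  [cite: Neumaier2004CompleteSearch, §11]
-/

open Finset

namespace Literature.MathematicalPhysics.QuantumLattice.TTPrimeFree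

open Literature.Analysis.ValidatedNumerics.Numerics ThermodynamicLimit

/-! ### §1 The doubly-filled reading of a polarised-sea certificate: Hartree–Fock caps -/

/-- An affine function on `[s₁, s₂]` is at most the larger of its end values. [folklore] -/
private theorem affine_le_max_ends' {a b s s₁ s₂ : ℝ} (h₁ : s₁ ≤ s) (h₂ : s ≤ s₂) :
    a + s * b ≤ max (a + s₁ * b) (a + s₂ * b) := by
  rcases le_total 0 b with hb | hb
  · exact le_max_of_le_right (by nlinarith)
  · exact le_max_of_le_left (by nlinarith)

/-- From the scaled upper end point: `x ∈ I`, `I.hi ≤ A·2⁴⁸` (in `ℚ`) ⟹ `x ≤ A`. [folklore] -/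
private theorem le_of_mem_of_hi_le' {x : ℝ} {I : FI} {A : ℚ} (hx : FI.mem x I)
    (h : ((I.hi : ℤ) : ℚ) ≤ A * SC) : x ≤ (A : ℝ) := by
  have h1 := hx.2
  have h2 : ((I.hi : ℤ) : ℝ) ≤ (A : ℝ) * SC := by
    have := (Rat.cast_le (K := ℝ)).2 h
    push_cast at this
    exact this
  nlinarith [SC_pos]

/-- **What the certificate certifies about the PLANE.** If `polarizedPlaneCheck M t s₁ s₂ sel card A B = true`
then the selected cell set `S = {c | sel c.1 c.2}` has exactly `card` cells and, for every `s ∈ [s₁, s₂]`,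
`t·A_S + s·B_S ≤ A + s·B` where `A_S = (1/M²) Σ_S (-2)(σᵢ + σⱼ)`, `B_S = (1/M²) Σ_S (-4) σᵢσⱼ` are the
coefficients of the grid-cell sea plane (enclosed by the interval engine). [cite: Neumaier2004CompleteSearch, §11] -/
theorem plane_le_of_polarizedPlaneCheck {M : ℕ} (hM : 0 < M) {t s₁ s₂ : ℚ}
    {sel : ℕ → ℕ → Bool} {card : ℕ} {A B : ℚ}
    (h : polarizedPlaneCheck M t s₁ s₂ sel card A B = true) :
    (Finset.univ.filter fun c : Fin M × Fin M => sel c.1 c.2 = true).card = card ∧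
      ∀ s : ℝ, (s₁ : ℝ) ≤ s → s ≤ (s₂ : ℝ) →
        (t : ℝ) * (1 / (M : ℝ) ^ 2 * ∑ c ∈ (Finset.univ.filter fun c : Fin M × Fin M => sel c.1 c.2 = true),
            (-2) * (gridSigma M c.1 + gridSigma M c.2)) +
          s * (1 / (M : ℝ) ^ 2 * ∑ c ∈ (Finset.univ.filter fun c : Fin M × Fin M => sel c.1 c.2 = true),
            (-4) * (gridSigma M c.1 * gridSigma M c.2)) ≤ (A : ℝ) + s * (B : ℝ) := by
  simp only [polarizedPlaneCheck, Bool.and_eq_true, decide_eq_true_eq] at h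
  obtain ⟨⟨⟨hcount, _⟩, hA₁⟩, hA₂⟩ := h
  have hMr : (0 : ℝ) < M := by exact_mod_cast hM
  set S : Finset (Fin M × Fin M) := Finset.univ.filter fun c => sel c.1 c.2 = true with hS
  have bridge : ∀ (g : ℕ → ℕ → ℝ), ∑ c ∈ S, g c.1 c.2 =
      ∑ i ∈ Finset.range M, ∑ j ∈ Finset.range M, if sel i j = true then g i j else 0 := by
    intro g
    rw [hS, Finset.sum_filter, Fintype.sum_prod_type]
    rw [← Fin.sum_univ_eq_sum_range (fun i => ∑ j ∈ Finset.range M, if sel i j = true then g i j else 0)]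
    refine Finset.sum_congr rfl fun i _ => ?_
    rw [← Fin.sum_univ_eq_sum_range (fun j => if sel i j = true then g i j else 0)]
  have bridgeN : ∀ (g : ℕ → ℕ → ℕ), ∑ c ∈ S, g c.1 c.2 =
      ∑ i ∈ Finset.range M, ∑ j ∈ Finset.range M, if sel i j = true then g i j else 0 := by
    intro g
    rw [hS, Finset.sum_filter, Fintype.sum_prod_type]
    rw [← Fin.sum_univ_eq_sum_range (fun i => ∑ j ∈ Finset.range M, if sel i j = true then g i j else 0)]
    refine Finset.sum_congr rfl fun i _ => ?_
    rw [← Fin.sum_univ_eq_sum_range (fun j => if sel i j = true then g i j else 0)]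
  have hScard : S.card = card := by
    rw [← hcount, Finset.card_eq_sum_ones, countSel, sumNat_eq]
    have hb := bridgeN (fun _ _ => 1)
    beta_reduce at hb
    rw [hb]
    refine Finset.sum_congr rfl fun i _ => ?_
    rw [sumNat_eq]
  refine ⟨hScard, fun s hs₁ hs₂ => ?_⟩
  have hσ : ∀ i, i < M → FI.mem (gridSigma M i) (gridSigmaFI M i) := fun i _ => mem_gridSigmaFI hM i
  have hAsum : FI.mem (∑ c ∈ S, (-2) * (gridSigma M c.1 + gridSigma M c.2)) (planeASum M sel) := by
    rw [bridge (fun i j => (-2) * (gridSigma M i + gridSigma M j))]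
    refine mem_selSumFI fun i j hi hj => ?_
    have := FI.mem_mulInt (FI.mem_add (hσ i hi) (hσ j hj)) (-2)
    convert this using 1; push_cast; ring
  have hBsum : FI.mem (∑ c ∈ S, (-4) * (gridSigma M c.1 * gridSigma M c.2)) (planeBSum M sel) := by
    rw [bridge (fun i j => (-4) * (gridSigma M i * gridSigma M j))]
    refine mem_selSumFI fun i j hi hj => ?_
    have := FI.mem_mulInt (FI.mem_mul (hσ i hi) (hσ j hj)) (-4)
    convert this using 1; push_cast; ring
  set AS : ℝ := 1 / (M : ℝ) ^ 2 * ∑ c ∈ S, (-2) * (gridSigma M c.1 + gridSigma M c.2) with hAS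
  set BS : ℝ := 1 / (M : ℝ) ^ 2 * ∑ c ∈ S, (-4) * (gridSigma M c.1 * gridSigma M c.2) with hBS
  have hMM : 0 < M * M := Nat.mul_pos hM hM
  have hA : FI.mem AS ((planeASum M sel).divNat (M * M)) := by
    have := FI.mem_divNat hAsum hMM
    convert this using 1
    rw [hAS]; push_cast; field_simp
  have hB : FI.mem BS ((planeBSum M sel).divNat (M * M)) := by
    have := FI.mem_divNat hBsum hMM
    convert this using 1
    rw [hBS]; push_cast; field_simp
  have hend : ∀ s' : ℚ, FI.mem ((t : ℝ) * AS + (s' : ℝ) * (BS - (B : ℝ)))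
      (((FI.ofRat t).mul ((planeASum M sel).divNat (M * M))).add
        ((FI.ofRat s').mul (((planeBSum M sel).divNat (M * M)).sub (FI.ofRat B)))) := fun s' =>
    FI.mem_add (FI.mem_mul (FI.mem_ofRat t) hA)
      (FI.mem_mul (FI.mem_ofRat s') (FI.mem_sub hB (FI.mem_ofRat B)))
  have e₁ : (t : ℝ) * AS + (s₁ : ℝ) * (BS - (B : ℝ)) ≤ A := le_of_mem_of_hi_le' (hend s₁) hA₁
  have e₂ : (t : ℝ) * AS + (s₂ : ℝ) * (BS - (B : ℝ)) ≤ A := le_of_mem_of_hi_le' (hend s₂) hA₂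
  have emid : (t : ℝ) * AS + s * (BS - (B : ℝ)) ≤ A :=
    (affine_le_max_ends' hs₁ hs₂).trans (max_le e₁ e₂)
  calc (t : ℝ) * AS + s * BS = (t : ℝ) * AS + s * (BS - (B : ℝ)) + s * (B : ℝ) := by ring
    _ ≤ (A : ℝ) + s * (B : ℝ) := by linarith

/-- **HARTREE–FOCK CAP FROM THE CERTIFICATE.** If `polarizedPlaneCheck M t s₁ s₂ sel card A B = true` then
for every `U ≥ 0`, every density `n < 2` with `n·M² = 2·card` and every `t' ∈ [s₁, s₂]`:
`e(t, t', U, n) ≤ 2(A + t'·B) + U(n/2)²` — the plane waves over the selected cells filled with BOTH spins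
(`energyDensityTT'_le_freeSea_plane`; the interaction of the paramagnetic Slater determinant is exactly
`U(n/2)²`). The same certificate gives the `U`-uniform polarised cap `A + t'B` at density `card/M²`.
[cite: BachLiebSolovej1994, eq. (2c.36)] -/
theorem energyDensityTT'_le_hartreeFock_of_polarizedPlaneCheck {M : ℕ} (hM : 0 < M) {t s₁ s₂ : ℚ}
    {sel : ℕ → ℕ → Bool} {card : ℕ} {A B : ℚ}
    (h : polarizedPlaneCheck M t s₁ s₂ sel card A B = true) {U : ℝ} (hU : 0 ≤ U) {n : ℝ}
    (hn : n * (M : ℝ) ^ 2 = 2 * card) (hn2 : n < 2) {s : ℝ} (hs₁ : (s₁ : ℝ) ≤ s) (hs₂ : s ≤ (s₂ : ℝ)) :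
    energyDensityTT' (t : ℝ) s U n ≤ 2 * ((A : ℝ) + s * (B : ℝ)) + U * (n / 2) ^ 2 := by
  obtain ⟨hScard, hplane⟩ := plane_le_of_polarizedPlaneCheck hM h
  set S : Finset (Fin M × Fin M) := Finset.univ.filter fun c => sel c.1 c.2 = true with hS
  have hMr : (0 : ℝ) < M := by exact_mod_cast hM
  have hM2 : (0 : ℝ) < (M : ℝ) ^ 2 := by positivity
  have hSlt : S.card < M ^ 2 := by
    have h1 : (2 : ℝ) * (S.card : ℝ) < 2 * (M : ℝ) ^ 2 := by
      rw [hScard, ← hn]; nlinarith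
    have h2 : (S.card : ℝ) < ((M ^ 2 : ℕ) : ℝ) := by push_cast; linarith
    exact_mod_cast h2
  have hn' : n = 2 * (S.card : ℝ) / (M : ℝ) ^ 2 := by
    rw [hScard, eq_div_iff hM2.ne']; linarith
  have hn2' : (S.card : ℝ) / (M : ℝ) ^ 2 = n / 2 := by rw [hn']; ring
  have hfree := energyDensityTT'_le_freeSea_plane (t : ℝ) s hU hM S hSlt
  rw [← hn', hn2'] at hfree
  have key := hplane s hs₁ hs₂
  have e1 : (t : ℝ) * (2 / (M : ℝ) ^ 2 * ∑ c ∈ S, (-2) * (gridSigma M c.1 + gridSigma M c.2)) +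
      s * (2 / (M : ℝ) ^ 2 * ∑ c ∈ S, (-4) * (gridSigma M c.1 * gridSigma M c.2)) =
      2 * ((t : ℝ) * (1 / (M : ℝ) ^ 2 * ∑ c ∈ S, (-2) * (gridSigma M c.1 + gridSigma M c.2)) +
        s * (1 / (M : ℝ) ^ 2 * ∑ c ∈ S, (-4) * (gridSigma M c.1 * gridSigma M c.2))) := by ring
  linarith

/-- **HF cap on a `(t', U)`-rectangle, affine in `t'`** (the `hCa`/`hCb` input shape of
`energyDensityTT'_cap_Icc₃_of_affineCaps`): on `[s₁, s₂] × [U₀, U₃]` (`U₀ ≥ 0`) at density `n`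
(`n·M² = 2·card`, `n < 2`): `e(t, s, u, n) ≤ (2A + U₃(n/2)²) + s·(2B)`. [cite: BachLiebSolovej1994, eq. (2c.36)] -/
theorem energyDensityTT'_le_hartreeFock_on_rect_of_polarizedPlaneCheck {M : ℕ} (hM : 0 < M) {t s₁ s₂ : ℚ}
    {sel : ℕ → ℕ → Bool} {card : ℕ} {A B : ℚ}
    (h : polarizedPlaneCheck M t s₁ s₂ sel card A B = true) {n : ℝ} (hn : n * (M : ℝ) ^ 2 = 2 * card)
    (hn2 : n < 2) {U₀ U₃ : ℝ} (hU₀ : 0 ≤ U₀) :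
    ∀ s u : ℝ, (s₁ : ℝ) ≤ s → s ≤ (s₂ : ℝ) → U₀ ≤ u → u ≤ U₃ →
      energyDensityTT' (t : ℝ) s u n ≤ (2 * (A : ℝ) + U₃ * (n / 2) ^ 2) + s * (2 * (B : ℝ)) := by
  intro s u hs₁ hs₂ hu₁ hu₂
  have h1 := energyDensityTT'_le_hartreeFock_of_polarizedPlaneCheck hM h (hU₀.trans hu₁) hn hn2 hs₁ hs₂
  have h2 : u * (n / 2) ^ 2 ≤ U₃ * (n / 2) ^ 2 := mul_le_mul_of_nonneg_right hu₂ (sq_nonneg _)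
  linarith

/-- **HF cap on a 3-D slab in S2-seam shape** from two certificates at the density ends `na ≤ nb < 2`
(`na·Ma² = 2·carda`, `nb·Mb² = 2·cardb`) on the same `t'`-interval, `U ∈ [U₀, U₃]`, `U₀ ≥ 0`: on
`Set.Icc ![U₀, s₁, na] ![U₃, s₂, nb]`, `e(t, θ 1, θ 0, θ 2)` is below the corner maximum of the two planes
`(2Aa + U₃(na/2)²) + s(2Ba)`, `(2Ab + U₃(nb/2)²) + s(2Bb)` (convexity in the density between the ends).
[cite: BachLiebSolovej1994, eq. (2c.36)] -/
theorem energyDensityTT'_hartreeFockCap_Icc₃_of_polarizedPlaneChecks {Ma Mb : ℕ} (hMa : 0 < Ma) (hMb : 0 < Mb)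
    {t s₁ s₂ : ℚ} {sela selb : ℕ → ℕ → Bool} {carda cardb : ℕ} {Aa Ba Ab Bb : ℚ}
    (ha : polarizedPlaneCheck Ma t s₁ s₂ sela carda Aa Ba = true)
    (hb : polarizedPlaneCheck Mb t s₁ s₂ selb cardb Ab Bb = true)
    {na nb : ℝ} (hna0 : 0 ≤ na) (hna2 : na < 2) (hnb2 : nb < 2)
    (hna : na * (Ma : ℝ) ^ 2 = 2 * carda) (hnb : nb * (Mb : ℝ) ^ 2 = 2 * cardb) {U₀ U₃ : ℝ} (hU₀ : 0 ≤ U₀) :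
    ∀ θ ∈ Set.Icc (![U₀, s₁, na] : Fin 3 → ℝ) ![U₃, s₂, nb],
      energyDensityTT' (t : ℝ) (θ 1) (θ 0) (θ 2) ≤
        max (max ((2 * (Aa : ℝ) + U₃ * (na / 2) ^ 2) + (s₁ : ℝ) * (2 * (Ba : ℝ)))
              ((2 * (Aa : ℝ) + U₃ * (na / 2) ^ 2) + (s₂ : ℝ) * (2 * (Ba : ℝ))))
          (max ((2 * (Ab : ℝ) + U₃ * (nb / 2) ^ 2) + (s₁ : ℝ) * (2 * (Bb : ℝ)))
              ((2 * (Ab : ℝ) + U₃ * (nb / 2) ^ 2) + (s₂ : ℝ) * (2 * (Bb : ℝ)))) :=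
  energyDensityTT'_cap_Icc₃_of_affineCaps (t : ℝ) hU₀ hna0 hnb2
    (energyDensityTT'_le_hartreeFock_on_rect_of_polarizedPlaneCheck hMa ha hna hna2 hU₀)
    (energyDensityTT'_le_hartreeFock_on_rect_of_polarizedPlaneCheck hMb hb hnb hnb2 hU₀)

end Literature.MathematicalPhysics.QuantumLattice.TTPrimeFree

namespace Literature.MathematicalPhysics.QuantumLattice.ThermodynamicLimit

open Literature.Probability.LatticeModels

/-! ### §2 The floor of a box from two density-affine free floors at the `t'` ends -/

/-- An affine function of `n` on `[n₁, n₂]` is above the smaller of its end values. [folklore] -/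
private theorem min_ends_le_affine {F μ n n₁ n₂ : ℝ} (h₁ : n₁ ≤ n) (h₂ : n ≤ n₂) :
    min (F + μ * n₁) (F + μ * n₂) ≤ F + μ * n := by
  rcases le_total 0 μ with hμ | hμ
  · exact (min_le_left _ _).trans (by nlinarith)
  · exact (min_le_right _ _).trans (by nlinarith)

/-- **FLOOR ON A BOX FROM TWO AFFINE FLOORS AT THE `t'` ENDS.** Let `s₁ < s₂` and suppose that at
`t' = s₁` and at `t' = s₂` the energy density has floors AFFINE in the density and uniform in `U ≥ 0`,
`F₁ + μ₁·n ≤ e(t, s₁, U, n)` and `F₂ + μ₂·n ≤ e(t, s₂, U, n)` for all `0 ≤ n < 2` (the conclusion shape of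
the kernel free-gas rows `FermiSeaCellRows.energyDensityTT'_one_ge_affine_cellTable64`: the bathtub bound
`μn + 2(2π)⁻²∫min(ε − μ, 0)` is the tangent line of the convex free energy). Then for every `U ≥ 0`, every
`t' ∈ [s₁, s₂]` and every `n ∈ [n₁, n₂] ⊂ [0, 2)`:
`min (min (F₁ + μ₁n₁) (F₁ + μ₁n₂)) (min (F₂ + μ₂n₁) (F₂ + μ₂n₂)) ≤ e(t, t', U, n)` — each end floor is
between its two density-end values, and `t' ↦ e` is CONCAVE (`energyDensityTT'_ge_convexComb`), so above
the chord of the two end floors. [cite: Israel1979, Thm. I.3.4] -/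
theorem energyDensityTT'_ge_of_affineFloors (t : ℝ) {s₁ s₂ n₁ n₂ F₁ μ₁ F₂ μ₂ : ℝ} (hs : s₁ < s₂)
    (hn₁ : 0 ≤ n₁) (hn₂ : n₂ < 2)
    (h₁ : ∀ ⦃U : ℝ⦄, 0 ≤ U → ∀ ⦃n : ℝ⦄, 0 ≤ n → n < 2 → F₁ + μ₁ * n ≤ energyDensityTT' t s₁ U n)
    (h₂ : ∀ ⦃U : ℝ⦄, 0 ≤ U → ∀ ⦃n : ℝ⦄, 0 ≤ n → n < 2 → F₂ + μ₂ * n ≤ energyDensityTT' t s₂ U n)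
    {U s n : ℝ} (hU : 0 ≤ U) (hs₁ : s₁ ≤ s) (hs₂ : s ≤ s₂) (hn : n ∈ Set.Icc n₁ n₂) :
    min (min (F₁ + μ₁ * n₁) (F₁ + μ₁ * n₂)) (min (F₂ + μ₂ * n₁) (F₂ + μ₂ * n₂)) ≤
      energyDensityTT' t s U n := by
  have hn0 : 0 ≤ n := hn₁.trans hn.1
  have hn2 : n < 2 := lt_of_le_of_lt hn.2 hn₂
  set m : ℝ := min (min (F₁ + μ₁ * n₁) (F₁ + μ₁ * n₂)) (min (F₂ + μ₂ * n₁) (F₂ + μ₂ * n₂)) with hm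
  have e₁ : m ≤ energyDensityTT' t s₁ U n :=
    ((min_le_left _ _).trans (min_ends_le_affine hn.1 hn.2)).trans (h₁ hU hn0 hn2)
  have e₂ : m ≤ energyDensityTT' t s₂ U n :=
    ((min_le_right _ _).trans (min_ends_le_affine hn.1 hn.2)).trans (h₂ hU hn0 hn2)
  have hds : 0 < s₂ - s₁ := by linarith
  set a : ℝ := (s₂ - s) / (s₂ - s₁) with ha
  set b : ℝ := (s - s₁) / (s₂ - s₁) with hb
  have ha0 : 0 ≤ a := div_nonneg (by linarith) hds.le
  have hb0 : 0 ≤ b := div_nonneg (by linarith) hds.le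
  have hab : a + b = 1 := by
    rw [ha, hb, ← add_div, div_eq_one_iff_eq hds.ne']
    ring
  have hcomb : a * s₁ + b * s₂ = s := by
    rw [ha, hb]
    field_simp
    ring
  have h := energyDensityTT'_ge_convexComb t hn0 hn2 hU hU ha0 hb0 hab e₁ e₂
  rw [hcomb, show a * U + b * U = U by rw [← add_mul, hab, one_mul],
    show a * m + b * m = m by rw [← add_mul, hab, one_mul]] at h
  exact h

/-- **The same floor in S2-seam shape**: on `Set.Icc ![U₁, s₁, n₁] ![U₂, s₂, n₂]` (`0 ≤ U₁`, `s₁ < s₂`,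
`0 ≤ n₁`, `n₂ < 2`; coordinates `(U/t, t'/t, n)`), `m ≤ e(t, θ 1, θ 0, θ 2)` for every `m` below the four
corner values of the two affine end floors (so a decimal literal can be recorded). [cite: Israel1979, Thm. I.3.4] -/
theorem energyDensityTT'_floor_Icc₃_of_affineFloors (t : ℝ) {U₁ U₂ s₁ s₂ n₁ n₂ F₁ μ₁ F₂ μ₂ m : ℝ}
    (hU₁ : 0 ≤ U₁) (hs : s₁ < s₂) (hn₁ : 0 ≤ n₁) (hn₂ : n₂ < 2)
    (h₁ : ∀ ⦃U : ℝ⦄, 0 ≤ U → ∀ ⦃n : ℝ⦄, 0 ≤ n → n < 2 → F₁ + μ₁ * n ≤ energyDensityTT' t s₁ U n)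
    (h₂ : ∀ ⦃U : ℝ⦄, 0 ≤ U → ∀ ⦃n : ℝ⦄, 0 ≤ n → n < 2 → F₂ + μ₂ * n ≤ energyDensityTT' t s₂ U n)
    (hm₁₁ : m ≤ F₁ + μ₁ * n₁) (hm₁₂ : m ≤ F₁ + μ₁ * n₂) (hm₂₁ : m ≤ F₂ + μ₂ * n₁)
    (hm₂₂ : m ≤ F₂ + μ₂ * n₂) :
    ∀ θ ∈ Set.Icc (![U₁, s₁, n₁] : Fin 3 → ℝ) ![U₂, s₂, n₂], m ≤ energyDensityTT' t (θ 1) (θ 0) (θ 2) := by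
  intro θ hθ
  obtain ⟨⟨h1, _⟩, ⟨h3, h4⟩, ⟨h5, h6⟩⟩ := mem_Icc_vec3_iff.1 hθ
  have h := energyDensityTT'_ge_of_affineFloors t hs hn₁ hn₂ h₁ h₂ (hU₁.trans h1) h3 h4 ⟨h5, h6⟩
  exact le_trans (le_min (le_min hm₁₁ hm₁₂) (le_min hm₂₁ hm₂₂)) h

/-- **Floor on a box from ONE affine floor at a `t'`-POINT** (`s₁ = s₂ = s₀`, e.g. the `t' = 0` or
`t' = -1/4` faces): on `Set.Icc ![U₁, s₀, n₁] ![U₂, s₀, n₂]`, `m ≤ e` for `m` below the two density-end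
values. [cite: LiebLoss1993, §8, Theorem 8.2] -/
theorem energyDensityTT'_floor_Icc₃_of_affineFloor_point (t : ℝ) {U₁ U₂ s₀ n₁ n₂ F μ m : ℝ}
    (hU₁ : 0 ≤ U₁) (hn₁ : 0 ≤ n₁) (hn₂ : n₂ < 2)
    (h : ∀ ⦃U : ℝ⦄, 0 ≤ U → ∀ ⦃n : ℝ⦄, 0 ≤ n → n < 2 → F + μ * n ≤ energyDensityTT' t s₀ U n)
    (hm₁ : m ≤ F + μ * n₁) (hm₂ : m ≤ F + μ * n₂) :
    ∀ θ ∈ Set.Icc (![U₁, s₀, n₁] : Fin 3 → ℝ) ![U₂, s₀, n₂], m ≤ energyDensityTT' t (θ 1) (θ 0) (θ 2) := by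
  intro θ hθ
  obtain ⟨⟨h1, _⟩, ⟨h3, h4⟩, ⟨h5, h6⟩⟩ := mem_Icc_vec3_iff.1 hθ
  have hs : θ 1 = s₀ := le_antisymm h4 h3
  rw [hs]
  exact le_trans ((le_min hm₁ hm₂).trans (min_ends_le_affine h5 h6))
    (h (hU₁.trans h1) (hn₁.trans h5) (lt_of_le_of_lt h6 hn₂))

/-! ### §3 The sandwich in S2-seam shape -/

/-- **THE FREE-FERMION SANDWICH OF A BOX.** A floor word `F ≤ e` (§2) and two cap words `e ≤ C₁`, `e ≤ C₂`
(§1 Hartree–Fock and/or the `U`-uniform polarised slab cap `energyDensityTT'_cap_Icc₃_of_polarizedPlaneChecks`)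
on the same seam box give the two-sided word `F ≤ e ∧ e ≤ min C₁ C₂` there — with NO registry hypothesis when
the three inputs are kernel certificates. [cite: Neumaier2004CompleteSearch, §11] -/
theorem energyDensityTT'_sandwich_Icc₃ (t : ℝ) {lo hi : Fin 3 → ℝ} {F C₁ C₂ : ℝ}
    (hF : ∀ θ ∈ Set.Icc lo hi, F ≤ energyDensityTT' t (θ 1) (θ 0) (θ 2))
    (hC₁ : ∀ θ ∈ Set.Icc lo hi, energyDensityTT' t (θ 1) (θ 0) (θ 2) ≤ C₁)
    (hC₂ : ∀ θ ∈ Set.Icc lo hi, energyDensityTT' t (θ 1) (θ 0) (θ 2) ≤ C₂) :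
    ∀ θ ∈ Set.Icc lo hi,
      F ≤ energyDensityTT' t (θ 1) (θ 0) (θ 2) ∧ energyDensityTT' t (θ 1) (θ 0) (θ 2) ≤ min C₁ C₂ :=
  energyDensityTT'_window_Icc₃_of_floor_of_cap t hF (energyDensityTT'_cap_Icc₃_min t hC₁ hC₂)

/-- **Weakening to recorded literals.** A window `[F, C]` on a box and literals `F' ≤ F`, `C ≤ C'` give the
window `[F', C']` (the form in which decimal pairs are published). [cite: Neumaier2004CompleteSearch, §11] -/
theorem energyDensityTT'_window_Icc₃_mono (t : ℝ) {lo hi : Fin 3 → ℝ} {F C F' C' : ℝ}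
    (h : ∀ θ ∈ Set.Icc lo hi,
      F ≤ energyDensityTT' t (θ 1) (θ 0) (θ 2) ∧ energyDensityTT' t (θ 1) (θ 0) (θ 2) ≤ C)
    (hF : F' ≤ F) (hC : C ≤ C') :
    ∀ θ ∈ Set.Icc lo hi,
      F' ≤ energyDensityTT' t (θ 1) (θ 0) (θ 2) ∧ energyDensityTT' t (θ 1) (θ 0) (θ 2) ≤ C' :=
  fun θ hθ => ⟨hF.trans (h θ hθ).1, (h θ hθ).2.trans hC⟩

/-! ### §4 Reading a box word on a sub-box (router box ⊂ grid-rounded certificate box) -/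

/-- **A word on a box holds on every sub-box** (six scalar inequalities between the `![…]` corners): the
certificates of §1–§3 live on density slabs rounded OUTWARD to the certificate grid and on `t'`-columns
bracketing the router's interval; the router box of record is read off by this restriction.
[cite: Neumaier2004CompleteSearch, §11] -/
theorem forall_mem_Icc_vec3_mono {P : (Fin 3 → ℝ) → Prop} {a₀ a₁ a₂ b₀ b₁ b₂ a₀' a₁' a₂' b₀' b₁' b₂' : ℝ}
    (h : ∀ θ ∈ Set.Icc (![a₀, a₁, a₂] : Fin 3 → ℝ) ![b₀, b₁, b₂], P θ)
    (h₀ : a₀ ≤ a₀') (h₁ : a₁ ≤ a₁') (h₂ : a₂ ≤ a₂') (h₀' : b₀' ≤ b₀) (h₁' : b₁' ≤ b₁) (h₂' : b₂' ≤ b₂) :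
    ∀ θ ∈ Set.Icc (![a₀', a₁', a₂'] : Fin 3 → ℝ) ![b₀', b₁', b₂'], P θ := by
  intro θ hθ
  obtain ⟨⟨k1, k2⟩, ⟨k3, k4⟩, ⟨k5, k6⟩⟩ := mem_Icc_vec3_iff.1 hθ
  exact h θ (mem_Icc_vec3_iff.2 ⟨⟨h₀.trans k1, k2.trans h₀'⟩, ⟨h₁.trans k3, k4.trans h₁'⟩,
    ⟨h₂.trans k5, k6.trans h₂'⟩⟩)

/-- **Floor word on a `t'`-extended box, Lipschitz price `4·n₂` per unit of `t'`** (floor-only twin of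
`energyDensityTT'_window_Icc₃_tPrime`: a floor `F` on `Set.Icc ![U₁, s₁, n₁] ![U₂, s₂, n₂]` gives
`F − 4 n₂ · max δ δ'` on the box with `t'`-range `[s₁ − δ, s₂ + δ']`, `δ ≥ 0`) — used for the
slivers of router boxes beyond the `|t'| ≤ 1/2` domain of the kernel free-gas rows (Hg1201: `t'/t_eff` down to `−0.54`).
[cite: Israel1979, Thm. I.3.4] -/
theorem energyDensityTT'_floor_Icc₃_tPrime_extend (t : ℝ) {U₁ U₂ s₁ s₂ n₁ n₂ F δ δ' : ℝ} (hU₁ : 0 ≤ U₁)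
    (hs : s₁ ≤ s₂) (hn₁ : 0 ≤ n₁) (hn₂ : n₂ < 2) (hδ : 0 ≤ δ)
    (hF : ∀ θ ∈ Set.Icc (![U₁, s₁, n₁] : Fin 3 → ℝ) ![U₂, s₂, n₂], F ≤ energyDensityTT' t (θ 1) (θ 0) (θ 2)) :
    ∀ θ ∈ Set.Icc (![U₁, s₁ - δ, n₁] : Fin 3 → ℝ) ![U₂, s₂ + δ', n₂],
      F - 4 * n₂ * max δ δ' ≤ energyDensityTT' t (θ 1) (θ 0) (θ 2) := by
  intro θ hθ
  obtain ⟨⟨k1, k2⟩, ⟨k3, k4⟩, ⟨k5, k6⟩⟩ := mem_Icc_vec3_iff.1 hθ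
  have hF' : ∀ u s m : ℝ, U₁ ≤ u → u ≤ U₂ → s₁ ≤ s → s ≤ s₂ → n₁ ≤ m → m ≤ n₂ →
      F ≤ energyDensityTT' t s u m := fun u s m hu₁ hu₂ hs₁ hs₂ hm₁ hm₂ =>
    forall₃_of_forall_mem_Icc_vec3 (P := fun u s m => F ≤ energyDensityTT' t s u m) hF hu₁ hu₂ hs₁ hs₂ hm₁ hm₂
  have h := energyDensityTT'_ge_of_cellFloor_tPrime t hU₁ hs hn₁ hn₂ hF' (s' := θ 1) k1 k2 k5 k6
  have hmax : max (max (s₁ - θ 1) (θ 1 - s₂)) 0 ≤ max δ δ' :=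
    max_le (max_le (by linarith [le_max_left δ δ']) (by linarith [le_max_right δ δ'])) (le_max_of_le_left hδ)
  have hn₂0 : 0 ≤ n₂ := hn₁.trans (k5.trans k6)
  nlinarith [mul_le_mul_of_nonneg_left hmax (by positivity : (0:ℝ) ≤ 4 * n₂)]

end Literature.MathematicalPhysics.QuantumLattice.ThermodynamicLimit
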